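import Summits.Langlands.Langlands.Theses.ExteriorSquareAscent
import Summits.Langlands.Langlands.Theorems.ExteriorSquareAscentRestOfReciprocityOfR
import Summits.Langlands.Langlands.Theorems.RamifiedCoefficientSeedSectorComplementJunctionOfR
import HarnessLib

/-!
# `ExteriorSquareAscent.RestOfReciprocityGivenJS` — item-level certificate (stmt-Langlands-18110, `--supports`)

The glue item of route `ExteriorSquareAscent` (rev 3 of its deciding theorem `closes`, binder `h8`) is

  `RestOfReciprocityGivenJS := PairLBoundaryJS → PairLPoleJS → RestOfReciprocity`,
  `RestOfReciprocity := IrreducibleGL4 → _root_.Langlands`,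

i.e. the route's open component ("the rest of the mountain") NET of the two Jacquet–Shalika pair-`L` formalisation debts
(Arthur–Clozel Ch. 3 §2 (2.2)–(2.3) for Borel–Jacquet data, items stmt-Langlands-13622 / stmt-Langlands-19093) and of the
route target `X = IrreducibleGL4`.  This file records, as kernel facts on the texts of EXISTING items and with no `sorry`,
no new definition and standard axioms, exactly what the item is:

* `restOfReciprocityGivenJS_iff` — by name, `S ↔ (PairLBoundaryJS → PairLPoleJS → IrreducibleGL4 → Langlands)` (`Iff.rfl`);
* `restOfReciprocityGivenJS_of_restOfReciprocity`, `restOfReciprocityGivenJS_of_langlands` — the seams `fun h _ _ => h` and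
  "the summit gives the item outright";
* `pairLBoundaryJS_iff`, `pairLPoleJS_iff` — the two JS binders ARE the Literature named facts
  `JacquetShalika1981_partialPairL_{boundary,pole}_repData` (`Iff.rfl`; `partialPairL` / `SatakeFamily` unfold by `delta`);
* `restOfReciprocityGivenJS_of_reciprocityUpToIrreducibilityR_text` — **CLOSURE MODULO stmt-Langlands-17925**: the text R of
  item stmt-Langlands-17925 (`IrreducibilityBySelfDuality.ReciprocityUpToIrreducibilityR`: reciprocity up to irreducibility for
  every pinned reciprocity datum, with the non-vacuity conjunct; written out verbatim because the decl lives in another route's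
  Theses module) implies the item — the JS binders of `S` feed the landed isobaric bootstrap
  (`RamifiedCoefficientSeedJunctionOfR.langlands_of_reciprocityUpToIrreducibilityR_text_of_JS`), `X` is discarded;
* `restOfReciprocityGivenJS_iff_imp_reciprocityUpToIrreducibilityR_text` — **UNCONDITIONALLY,
  `S ↔ (PairLBoundaryJS → PairLPoleJS → IrreducibleGL4 → R)`**: unlike the frame item `RestOfReciprocity` (whose
  characterisation `RestOfReciprocityOfR.restOfReciprocity_iff_of_JS` needs JS as outside hypotheses), the glue item carries JS
  inside, so its open content is literally "JS and X imply R" — and R asks for no irreducibility X could supply;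
* `not_restOfReciprocityGivenJS_iff` — `¬ S ↔ PairLBoundaryJS ∧ PairLPoleJS ∧ IrreducibleGL4 ∧ ¬ Langlands`: refuting the item
  means proving both JS debts and the route target AND refuting the audited summit;
* `langlands_iff_irreducibleGL4_and_restOfReciprocityGivenJS` — under JS, `Langlands ↔ IrreducibleGL4 ∧ S` (tightness:
  `RestOfReciprocityOfR.irreducibleGL4_of_langlands`).

Outcome supported: `blocked-on: stmt-Langlands-17925` (grounded OPEN-PROBLEM, 2026-08-17): the item closes in one line from
`restOfReciprocityGivenJS_of_reciprocityUpToIrreducibilityR_text` the day that item's `_holds` lands.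

References: K. Buzzard, T. Gee, LMS LNS 414 (2014), Conj. 3.2.1–3.2.2 [BuzzardGeeLMS2014]; J. Arthur, L. Clozel, Ann. Math.
Stud. 120, Ch. 3 §2 (2.2)–(2.3) [ArthurClozelAMS120]; H. Jacquet, J. Shalika, Amer. J. Math. 103 (1981) II, Prop. 3.6, Thm. 4.4
[JacquetShalikaAJM1981II]; J.-M. Fontaine, B. Mazur (1995), Conj. 1 [FontaineMazurGeometric1995].
-/

noncomputable section

set_option linter.dupNamespace false -- project-wide option; `Summit.Langlands.Langlands` is the mandated namespace

open Literature.NumberTheory.Automorphic Literature.NumberTheory.GaloisRepresentations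
open Summit.Langlands
open Summit.Langlands.Langlands.Theses.ExteriorSquareAscent
  (RestOfReciprocityGivenJS RestOfReciprocity IrreducibleGL4 PairLBoundaryJS PairLPoleJS)
open Summit.Langlands.Langlands.Theorems (RamifiedCoefficientSeedJunctionOfR.langlands_of_reciprocityUpToIrreducibilityR_text_of_JS
  RamifiedCoefficientSeedJunctionOfR.reciprocityUpToIrreducibilityR_text_of_langlands RestOfReciprocityOfR.irreducibleGL4_of_langlands)

namespace Summit.Langlands.Langlands.Theorems.RestOfReciprocityGivenJS

/-! ## 0. The item, by name -/

/-- The glue item IS `JS (2.2) → JS (2.3) → X → Langlands`, definitionally. [folklore] -/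
theorem restOfReciprocityGivenJS_iff :
    RestOfReciprocityGivenJS ↔ (PairLBoundaryJS → PairLPoleJS → IrreducibleGL4 → _root_.Langlands) :=
  Iff.rfl

/-- The seam of the route repair: the frame item gives the glue item (`fun h _ _ => h`). [folklore] -/
theorem restOfReciprocityGivenJS_of_restOfReciprocity (h : RestOfReciprocity) : RestOfReciprocityGivenJS :=
  fun _ _ => h

/-- The summit gives the glue item outright (discard all three antecedents). [folklore] -/
theorem restOfReciprocityGivenJS_of_langlands (hLang : _root_.Langlands) : RestOfReciprocityGivenJS :=
  fun _ _ _ => hLang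

/-- Granted the two JS binders, the glue item and the frame item coincide. [folklore] -/
theorem restOfReciprocityGivenJS_iff_restOfReciprocity (h7 : PairLBoundaryJS) (h6 : PairLPoleJS) :
    RestOfReciprocityGivenJS ↔ RestOfReciprocity :=
  ⟨fun h => h h7 h6, fun h _ _ => h⟩

/-! ## 1. The two JS binders ARE the Literature named facts (δ-bridges) -/

/-- The route item `PairLBoundaryJS` (stmt-Langlands-13622) IS the named fact
`JacquetShalika1981_partialPairL_boundary_repData` — Arthur–Clozel Ch. 3 (2.2) for Borel–Jacquet data — definitionally
(`partialPairL S α β` is the `tprod` written out in the item; `SatakeFamily F` is `HeightOneSpectrum (𝓞 F) → Multiset ℂ`).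
[cite: ArthurClozelAMS120, Ch. 3 §2 (2.2)] [cite: JacquetShalikaAJM1981II, Prop. 3.6 and Thm. 4.4] -/
theorem pairLBoundaryJS_iff : PairLBoundaryJS ↔ JacquetShalika1981_partialPairL_boundary_repData :=
  Iff.rfl

/-- The route item `PairLPoleJS` (stmt-Langlands-19093) IS the named fact `JacquetShalika1981_partialPairL_pole_repData` —
Arthur–Clozel Ch. 3 (2.3) for Borel–Jacquet data — definitionally.
[cite: ArthurClozelAMS120, Ch. 3 §2 (2.3)] [cite: JacquetShalikaAJM1981II, Prop. 3.6 and Thm. 4.4] -/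
theorem pairLPoleJS_iff : PairLPoleJS ↔ JacquetShalika1981_partialPairL_pole_repData :=
  Iff.rfl

/-! ## 2. Closure modulo item stmt-Langlands-17925, and the unconditional characterisation -/

/-- **CLOSURE MODULO stmt-Langlands-17925.**  The text R of item stmt-Langlands-17925 (reciprocity up to irreducibility for
every pinned reciprocity datum, plus non-vacuity `Nonempty (ReciprocityData F)`) implies the glue item: its JS binders feed
the landed isobaric bootstrap `RamifiedCoefficientSeedJunctionOfR.langlands_of_reciprocityUpToIrreducibilityR_text_of_JS`
(clause (B) is R's; clause (A)'s avatar and every a.e.-compatible `ρ'` are irreducible, hence equivalent by Chebotarev +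
Brauer–Nesbitt, hence conjugate), and the antecedent `X = IrreducibleGL4` is discarded.  The day `…_holds` of
stmt-Langlands-17925 lands, `restOfReciprocityGivenJS_of_reciprocityUpToIrreducibilityR_text R_holds` closes stmt-Langlands-18110.
[cite: BuzzardGeeLMS2014, Conj. 3.2.1 and Conj. 3.2.2] [cite: ArthurClozelAMS120, Ch. 3 §2 (2.2)–(2.3)] -/
theorem restOfReciprocityGivenJS_of_reciprocityUpToIrreducibilityR_text
    (hR : ∀ (F : Type) [Field F] [NumberField F], Nonempty (ReciprocityData F) ∧ ∀ (Rec : ReciprocityData F) (n : ℕ), 0 < n → ∀ hcpt : Literature.NumberTheory.Automorphic.isCompact_glFiniteIntegralLevel n F, (∀ π : Literature.NumberTheory.Automorphic.CuspidalAutomorphicRepData n F hcpt, π.1.IsLAlgebraic → ∀ (ℓ : ℕ) [Fact ℓ.Prime] (ι : PadicAlgCl ℓ ≃+* ℂ), ∃ ρ : Literature.NumberTheory.GaloisRepresentations.FramedGaloisRep F (PadicAlgCl ℓ) n, IsGeometricFramed Rec ρ ∧ Corresponds Rec ι π.1 ρ) ∧ GaloisToAutomorphic n Rec hcpt) :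
    RestOfReciprocityGivenJS :=
  fun h7 h6 _ =>
    RamifiedCoefficientSeedJunctionOfR.langlands_of_reciprocityUpToIrreducibilityR_text_of_JS
      (pairLBoundaryJS_iff.mp h7) (pairLPoleJS_iff.mp h6) hR

/-- **UNCONDITIONAL CHARACTERISATION — `S ↔ (JS (2.2) → JS (2.3) → X → R)`** with R the text of item
stmt-Langlands-17925: forward, `S` and its three antecedents give `Langlands`, of which R is a weakening
(`RamifiedCoefficientSeedJunctionOfR.reciprocityUpToIrreducibilityR_text_of_langlands`); backward, R and the two JS binders
give `Langlands` by the isobaric bootstrap, `X` unused.  So the open content of the glue item is exactly "JS and X imply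
reciprocity up to irreducibility for every pinned datum" — and since R asks for no irreducibility, X is inert in it.
[cite: BuzzardGeeLMS2014, Conj. 3.2.1 and Conj. 3.2.2] [cite: ArthurClozelAMS120, Ch. 3 §2 (2.2)–(2.3)] -/
theorem restOfReciprocityGivenJS_iff_imp_reciprocityUpToIrreducibilityR_text :
    RestOfReciprocityGivenJS ↔ (PairLBoundaryJS → PairLPoleJS → IrreducibleGL4 →
      ∀ (F : Type) [Field F] [NumberField F], Nonempty (ReciprocityData F) ∧ ∀ (Rec : ReciprocityData F) (n : ℕ), 0 < n → ∀ hcpt : Literature.NumberTheory.Automorphic.isCompact_glFiniteIntegralLevel n F, (∀ π : Literature.NumberTheory.Automorphic.CuspidalAutomorphicRepData n F hcpt, π.1.IsLAlgebraic → ∀ (ℓ : ℕ) [Fact ℓ.Prime] (ι : PadicAlgCl ℓ ≃+* ℂ), ∃ ρ : Literature.NumberTheory.GaloisRepresentations.FramedGaloisRep F (PadicAlgCl ℓ) n, IsGeometricFramed Rec ρ ∧ Corresponds Rec ι π.1 ρ) ∧ GaloisToAutomorphic n Rec hcpt) :=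
  ⟨fun h h7 h6 hX => RamifiedCoefficientSeedJunctionOfR.reciprocityUpToIrreducibilityR_text_of_langlands (h h7 h6 hX),
    fun h h7 h6 hX => RamifiedCoefficientSeedJunctionOfR.langlands_of_reciprocityUpToIrreducibilityR_text_of_JS
      (pairLBoundaryJS_iff.mp h7) (pairLPoleJS_iff.mp h6) (h h7 h6 hX)⟩

/-- **Granted the three antecedents, the glue item is EQUIVALENT to the text of item stmt-Langlands-17925.**
[cite: BuzzardGeeLMS2014, Conj. 3.2.1 and Conj. 3.2.2] [cite: ArthurClozelAMS120, Ch. 3 §2 (2.2)–(2.3)] -/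
theorem restOfReciprocityGivenJS_iff_reciprocityUpToIrreducibilityR_text (h7 : PairLBoundaryJS) (h6 : PairLPoleJS)
    (hX : IrreducibleGL4) :
    RestOfReciprocityGivenJS ↔
      ∀ (F : Type) [Field F] [NumberField F], Nonempty (ReciprocityData F) ∧ ∀ (Rec : ReciprocityData F) (n : ℕ), 0 < n → ∀ hcpt : Literature.NumberTheory.Automorphic.isCompact_glFiniteIntegralLevel n F, (∀ π : Literature.NumberTheory.Automorphic.CuspidalAutomorphicRepData n F hcpt, π.1.IsLAlgebraic → ∀ (ℓ : ℕ) [Fact ℓ.Prime] (ι : PadicAlgCl ℓ ≃+* ℂ), ∃ ρ : Literature.NumberTheory.GaloisRepresentations.FramedGaloisRep F (PadicAlgCl ℓ) n, IsGeometricFramed Rec ρ ∧ Corresponds Rec ι π.1 ρ) ∧ GaloisToAutomorphic n Rec hcpt :=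
  ⟨fun h => restOfReciprocityGivenJS_iff_imp_reciprocityUpToIrreducibilityR_text.mp h h7 h6 hX,
    fun h => restOfReciprocityGivenJS_of_reciprocityUpToIrreducibilityR_text h⟩

/-! ## 3. What refuting the item would mean; tightness under JS -/

/-- **`¬ S ↔ PairLBoundaryJS ∧ PairLPoleJS ∧ IrreducibleGL4 ∧ ¬ Langlands`**: refuting the glue item means proving both
Jacquet–Shalika debts and the route target AND refuting the audited summit. [folklore] -/
theorem not_restOfReciprocityGivenJS_iff :
    ¬ RestOfReciprocityGivenJS ↔ PairLBoundaryJS ∧ PairLPoleJS ∧ IrreducibleGL4 ∧ ¬ _root_.Langlands := by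
  rw [restOfReciprocityGivenJS_iff]
  constructor
  · intro h
    by_contra h'
    exact h fun h7 h6 hX => by_contra fun hL => h' ⟨h7, h6, hX, hL⟩
  · rintro ⟨h7, h6, hX, hL⟩ h
    exact hL (h h7 h6 hX)

/-- **Under JS, `Langlands ↔ IrreducibleGL4 ∧ RestOfReciprocityGivenJS`**: the glue item is exactly the summit modulo the route
target (tightness `RestOfReciprocityOfR.irreducibleGL4_of_langlands`: the summit proves X). [cite: BuzzardGeeLMS2014, Conj. 3.2.1 and §5.3] -/
theorem langlands_iff_irreducibleGL4_and_restOfReciprocityGivenJS (h7 : PairLBoundaryJS) (h6 : PairLPoleJS) :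
    _root_.Langlands ↔ IrreducibleGL4 ∧ RestOfReciprocityGivenJS :=
  ⟨fun h => ⟨RestOfReciprocityOfR.irreducibleGL4_of_langlands h, restOfReciprocityGivenJS_of_langlands h⟩,
    fun h => h.2 h7 h6 h.1⟩

end Summit.Langlands.Langlands.Theorems.RestOfReciprocityGivenJS

end
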